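import Summits.AtomisticToContinuum.Crystallization.Theorems.ChartedZeroExcessLayeredLatticeLiouvilleUA

/-!
# Zero-excess layered lattice Liouville — part UB (lens-2 g42, node «RigidCaccioppoli», (T3) glue, PROVED):
# `[C] RigidCaccioppoliPG ∧ Gehring-leaf ⇒ (M♭)₀ StrainSparsePG 0 ⇒ (M) StrainNonConcentrationPG`

The PROVED glue of the line `_16XH19(_tol)` (critic row 729 (ii)): the route-posited weak reverse Hölder inequality [C] of part UA,
fed into the named Literature fact `Literature.Analysis.PDE.ZatorskaGoldstein2005_localGehringLemmaCounting` (the local Gehring lemma for the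
counting measure of the door set, doubling constant `doorDoublingC δ` of part UA), yields higher summability `σ² ∈ ℓ^{1+ε}` with mean
`O(η^{1+ε})` on the window, whence the strain mass above ANY threshold `t₀ > 0` is `o(η)·nK` by Chebyshev in `ℓ^{1+ε}` — i.e. (M♭)₀, and (M) by
the dictionary of part TZM.  No cut-off, no compactness: the constants are explicit (§YB.2).
-/

noncomputable section

open scoped BigOperators
open MeasureTheory Set Metric Filter Topology
open Summit.AtomisticToContinuum.Crystallization.Theorems.ChartedPlanarOrderRigidityDoor (E3 atomsIn)
open Summit.AtomisticToContinuum.Crystallization.Theorems.ChartedPlanarOrderDensityDichotomy (μS IsSep nK nK_nonneg)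
open Summit.AtomisticToContinuum.Crystallization.Theorems.ChartedPlanarOrderCleanScaleP (IsCleanP IsDoorSetP)
open Summit.AtomisticToContinuum.Crystallization.Theorems.ChartedPlanarOrderMesoCut (LayeredHom EnvClose)
open Summit.AtomisticToContinuum.Crystallization.Theorems.ChartedPlanarOrderDoorLayered (atomsIn_subset)
open Summit.AtomisticToContinuum.Crystallization.Theorems.ChartedPlanarOrderDoorLayeredOsc (IsTwoShellAffineGood)
open Literature.Analysis.PDE (finavg ZatorskaGoldstein2005_localGehringLemmaCounting)

namespace Summit.AtomisticToContinuum.Crystallization.Theorems.ChartedZeroExcessLayeredLatticeLiouville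

/-! ### YB.1  Finite-average bookkeeping -/

/-- the finite average of a constant over a finite nonempty set is the constant. -/
theorem finavg_const_of_finite {K : Set E3} (hK : K.Finite) (hne : K.Nonempty) (c : ℝ) :
    finavg K (fun _ => c) = c := by
  have hpos : (0 : ℝ) < (K.ncard : ℝ) := by exact_mod_cast (Set.ncard_pos hK).2 hne
  unfold finavg
  rw [finsum_mem_eq_finite_toFinset_sum _ hK, Finset.sum_const, nsmul_eq_mul, ← Set.ncard_eq_toFinset_card _ hK]
  field_simp

/-- a finite average of nonnegative terms is nonnegative. -/
theorem finavg_nonneg_of_nonneg {K : Set E3} {h : E3 → ℝ} (hh : ∀ y, 0 ≤ h y) : 0 ≤ finavg K h := by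
  unfold finavg
  exact div_nonneg (finsum_nonneg fun y => finsum_nonneg fun _ => hh y) (Nat.cast_nonneg _)

/-- sum = count × average on a finite nonempty set. -/
theorem finsum_mem_eq_ncard_mul_finavg {K : Set E3} (hK : K.Finite) (hne : K.Nonempty) (h : E3 → ℝ) :
    ∑ᶠ y ∈ K, h y = (K.ncard : ℝ) * finavg K h := by
  have hpos : (0 : ℝ) < (K.ncard : ℝ) := by exact_mod_cast (Set.ncard_pos hK).2 hne
  unfold finavg
  field_simp

/-! ### YB.2  The glue: [C] ∧ Gehring-leaf ⇒ (M♭)₀ -/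

set_option maxHeartbeats 800000 in
/-- ★★★ **GLUE (PROVED): `RigidCaccioppoliPG ∧ (local counting Gehring lemma) ⇒ StrainSparsePG 0`.**
Constants: the leaf at `(C_D, C₁, d, λ, σ₀) := (doorDoublingC δ, b, d, 2, 2)` gives `(C₂, ε₁)`; with `C₂' := max C₂ 1`,
`C₃ := C₂'·A·(C_D³ + 1)`, `T := (t₀²)^{ε₁}`, `c := winDensC δ`, `Kε := T·ε/(c²(C₃+1))`, the thresholds are
`η₁ := min η₁^{[C]} (Kε^{1/ε₁}/(C₃+1))` and `R₁ := max R₁^{[C]} 12`.  On a fat window: [C]'s data `(Ψ', Q, σ)` on `win 8R`; the leaf at the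
root `0 ∈ S` with `Ω := ball 0 (8R)`, `f := σ²`, `g :≡ A·η` gives `(⨍_{B₁} (σ²)^{1+ε₁})^{1/(1+ε₁)} ≤ C₂(⨍_{B₂} σ² + Aη) ≤ C₃ η`
(`B₁ := S ∩ ball 0 (R+1) ⊇ win R`, `B₂ := S ∩ ball 0 (2R+2)`, `⨍_{B₂} σ² ≤ Aη·C_D³` by three doublings at the root); Chebyshev:
`T·strainMassAbove t₀ (win R) σ ≤ Σ_{B₁} (σ²)^{1+ε₁} ≤ #B₁·(C₃η)^{1+ε₁} ≤ c²·nK(win R)·C₃η·Kε ≤ T·ε·η·nK(win R)`. [this file, g42] -/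
theorem strainSparsePG_zero_of_rigidCaccioppoliPG {aHi Λ θ s : ℝ} (haHi : aHi ≤ 8 / 7)
    (hG : ZatorskaGoldstein2005_localGehringLemmaCounting) (hC : RigidCaccioppoliPG aHi Λ θ s) :
    StrainSparsePG 0 aHi Λ θ s := by
  intro δ hδ a ha Cg hCg
  obtain ⟨Cg', hCg', b, hb, d, hd0, hd1, A, hA, hK⟩ := hC δ hδ a ha Cg hCg
  refine ⟨Cg', hCg', ?_⟩
  intro t₀ _ ht₀ ε hε K₀ hK₀
  obtain ⟨C₂, ε₁, hε₁, hGe⟩ :=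
    hG (doorDoublingC δ) b d 2 2 (one_le_doorDoublingC hδ) hb hd0 hd1 one_lt_two one_lt_two
  obtain ⟨η₁', hη₁', R₁', hR₁', hmain⟩ := hK K₀ hK₀
  -- the constants
  set D : ℝ := doorDoublingC δ with hDdef
  have hD1 : 1 ≤ D := one_le_doorDoublingC hδ
  have hD0 : 0 ≤ D := by linarith
  set c : ℝ := winDensC δ with hcdef
  have hc1 : 1 ≤ c := one_le_winDensC hδ
  set C₂' : ℝ := max C₂ 1 with hC₂'def
  have hC₂'1 : 1 ≤ C₂' := le_max_right _ _
  have hC₂C₂' : C₂ ≤ C₂' := le_max_left _ _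
  set C₃ : ℝ := C₂' * (A * (D ^ 3 + 1)) with hC₃def
  have hC₃0 : 0 ≤ C₃ := by positivity
  have hC₃1 : (0 : ℝ) < C₃ + 1 := by linarith
  set T : ℝ := (t₀ ^ 2) ^ ε₁ with hTdef
  have hT : 0 < T := Real.rpow_pos_of_pos (by positivity) _
  set Kε : ℝ := T * ε / (c ^ 2 * (C₃ + 1)) with hKεdef
  have hKε : 0 < Kε := by positivity
  set ηs : ℝ := Kε ^ (1 / ε₁) / (C₃ + 1) with hηsdef
  have hηs : 0 < ηs := div_pos (Real.rpow_pos_of_pos hKε _) hC₃1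
  refine ⟨min η₁' ηs, lt_min hη₁' hηs, max R₁' 12, lt_max_of_lt_left hR₁', ?_⟩
  intro S hS hgood η hη hηle R hR L w hLw Ψ hΨ hfat
  have hη₁ : η ≤ η₁' := hηle.trans (min_le_left _ _)
  have hηs' : η ≤ ηs := hηle.trans (min_le_right _ _)
  have hR₁ : R₁' ≤ R := (le_max_left _ _).trans hR
  have hR12 : 12 ≤ R := (le_max_right _ _).trans hR
  obtain ⟨Ψ', hΨ', Q, σ, hd, hL2, hRH⟩ := hmain S hS hgood η hη hη₁ R hR₁ L w hLw Ψ hΨ hfat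
  refine ⟨Ψ', hΨ', Q, σ, isTiltStrainData_of_radius_le (by linarith) hd, ?_⟩
  -- door-set data for the leaf
  have hsep : IsSep δ S := hS.1.2.1
  have hCl : IsCleanP aHi (μS S) := hS.1.2.2.1
  have h0S : (0 : E3) ∈ S := hS.1.1
  have hfin : ∀ (x : E3) (r : ℝ), (S ∩ ball x r).Finite := fun x r => finite_inter_ball_of_isSep hδ hsep x r
  have hdoub : ∀ x ∈ S, ∀ r : ℝ, 0 < r →
      ((S ∩ ball x (2 * r)).ncard : ℝ) ≤ D * ((S ∩ ball x r).ncard : ℝ) :=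
    fun x hx r hr => ncard_inter_ball_two_mul_le haHi hδ hsep hCl hx hr
  have hAη : 0 ≤ A * η := mul_nonneg hA hη.le
  -- the leaf's hypothesis = [C] (ii) with `g ≡ A η`
  have hhyp : ∀ x ∈ S, ∀ r : ℝ, 0 < r → S ∩ ball x (2 * r) ⊆ ball (0 : E3) (8 * R) →
      finavg (S ∩ ball x r) (fun y => σ y ^ 2) ≤
        b * ((finavg (S ∩ ball x (2 * r)) (fun y => (fun y => σ y ^ 2) y ^ d)) ^ (1 / d) +
          finavg (S ∩ ball x (2 * r)) (fun _ => A * η)) := by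
    intro x hx r hr hsub2
    have hne : (S ∩ ball x (2 * r)).Nonempty := ⟨x, hx, mem_ball_self (by linarith)⟩
    rw [finavg_const_of_finite (hfin x (2 * r)) hne]
    exact hRH x hx r hr hsub2
  have hsub0 : S ∩ ball (0 : E3) (2 * (R + 1)) ⊆ ball (0 : E3) (8 * R) := by
    intro p hp
    have h := mem_ball.1 hp.2
    exact mem_ball.2 (by linarith)
  have hleaf := hGe E3 S hfin hdoub (ball (0 : E3) (8 * R)) isOpen_ball (fun y => σ y ^ 2) (fun _ => A * η)
    (fun x _ => sq_nonneg (σ x)) (fun _ _ => hAη) hhyp 0 h0S (R + 1) (by linarith) hsub0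
  -- the two root balls
  set B₁ : Set E3 := S ∩ ball (0 : E3) (R + 1) with hB₁def
  set B₂ : Set E3 := S ∩ ball (0 : E3) (2 * (R + 1)) with hB₂def
  have hB₁fin : B₁.Finite := hfin 0 _
  have hB₂fin : B₂.Finite := hfin 0 _
  have hne1 : B₁.Nonempty := ⟨0, h0S, mem_ball_self (by linarith)⟩
  have hne2 : B₂.Nonempty := ⟨0, h0S, mem_ball_self (by linarith)⟩
  have hB₁pos : (0 : ℝ) < (B₁.ncard : ℝ) := by exact_mod_cast (Set.ncard_pos hB₁fin).2 hne1
  have hB₂pos : (0 : ℝ) < (B₂.ncard : ℝ) := by exact_mod_cast (Set.ncard_pos hB₂fin).2 hne2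
  have hgavg : (finavg B₂ (fun _ => (A * η) ^ (2 : ℝ))) ^ (1 / (2 : ℝ)) = A * η := by
    rw [finavg_const_of_finite hB₂fin hne2, one_div, Real.rpow_rpow_inv hAη two_ne_zero]
  rw [hgavg] at hleaf
  -- `⨍_{B₂} σ² ≤ A η D³` by three doublings at the root and the L²-background (i)
  have hd1 := hdoub 0 h0S (2 * (R + 1)) (by linarith)
  have hd2 := hdoub 0 h0S (2 * (2 * (R + 1))) (by linarith)
  have hd3 := hdoub 0 h0S (2 * (2 * (2 * (R + 1)))) (by linarith)
  have hwin8 : atomsIn (μS S) 0 (8 * R) ⊆ S ∩ ball (0 : E3) (2 * (2 * (2 * (2 * (R + 1))))) := by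
    intro p hp
    rcases mem_atomsIn_iff.1 hp with ⟨hpS, hpn⟩
    exact ⟨hpS, mem_ball.2 (by rw [dist_zero_right]; linarith)⟩
  have hnK8 : nK (atomsIn (μS S) 0 (8 * R)) ≤ D ^ 3 * (B₂.ncard : ℝ) := by
    have h1 : nK (atomsIn (μS S) 0 (8 * R)) ≤ ((S ∩ ball (0 : E3) (2 * (2 * (2 * (2 * (R + 1)))))).ncard : ℝ) := by
      unfold nK
      exact_mod_cast Set.ncard_le_ncard hwin8 (hfin 0 _)
    calc nK (atomsIn (μS S) 0 (8 * R)) ≤ _ := h1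
      _ ≤ D * ((S ∩ ball (0 : E3) (2 * (2 * (2 * (R + 1))))).ncard : ℝ) := hd3
      _ ≤ D * (D * ((S ∩ ball (0 : E3) (2 * (2 * (R + 1)))).ncard : ℝ)) := mul_le_mul_of_nonneg_left hd2 hD0
      _ ≤ D * (D * (D * (B₂.ncard : ℝ))) := mul_le_mul_of_nonneg_left (mul_le_mul_of_nonneg_left hd1 hD0) hD0
      _ = D ^ 3 * (B₂.ncard : ℝ) := by ring
  have hsum2 : ∑ᶠ y ∈ B₂, σ y ^ 2 ≤ A * η * nK (atomsIn (μS S) 0 (8 * R)) := by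
    have hB₂sub : B₂ ⊆ atomsIn (μS S) 0 (8 * R) := by
      intro p hp
      refine mem_atomsIn_iff.2 ⟨hp.1, ?_⟩
      have h := mem_ball.1 hp.2
      rw [dist_zero_right] at h
      linarith
    exact (finsum_mem_le_finsum_mem_of_subset_of_nonneg (finite_atomsIn hδ hsep _) hB₂sub (fun x _ => sq_nonneg (σ x))).trans hL2
  have havg2 : finavg B₂ (fun y => σ y ^ 2) ≤ A * η * D ^ 3 := by
    unfold finavg
    rw [div_le_iff₀ hB₂pos]
    calc ∑ᶠ y ∈ B₂, σ y ^ 2 ≤ A * η * nK (atomsIn (μS S) 0 (8 * R)) := hsum2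
      _ ≤ A * η * (D ^ 3 * (B₂.ncard : ℝ)) := mul_le_mul_of_nonneg_left hnK8 hAη
      _ = A * η * D ^ 3 * (B₂.ncard : ℝ) := by ring
  -- the mean of `F := (σ²)^{1+ε₁}` on `B₁`
  have hε₁1 : (0 : ℝ) < 1 + ε₁ := by linarith
  have hFnn : ∀ y, 0 ≤ (σ y ^ 2) ^ (1 + ε₁) := fun y => Real.rpow_nonneg (sq_nonneg _) _
  have havgF_nn : 0 ≤ finavg B₁ (fun y => (σ y ^ 2) ^ (1 + ε₁)) := finavg_nonneg_of_nonneg hFnn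
  have hM : (finavg B₁ (fun y => (σ y ^ 2) ^ (1 + ε₁))) ^ (1 / (1 + ε₁)) ≤ C₃ * η := by
    have h2 : finavg B₂ (fun y => σ y ^ 2) + A * η ≤ A * η * D ^ 3 + A * η := by linarith
    have h3 : 0 ≤ finavg B₂ (fun y => σ y ^ 2) + A * η := by
      have := finavg_nonneg_of_nonneg (K := B₂) (fun y => sq_nonneg (σ y))
      linarith
    calc (finavg B₁ (fun y => (σ y ^ 2) ^ (1 + ε₁))) ^ (1 / (1 + ε₁))
        ≤ C₂ * (finavg B₂ (fun y => σ y ^ 2) + A * η) := hleaf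
      _ ≤ C₂' * (finavg B₂ (fun y => σ y ^ 2) + A * η) := mul_le_mul_of_nonneg_right hC₂C₂' h3
      _ ≤ C₂' * (A * η * D ^ 3 + A * η) := mul_le_mul_of_nonneg_left h2 (by linarith)
      _ = C₃ * η := by rw [hC₃def]; ring
  have havgF : finavg B₁ (fun y => (σ y ^ 2) ^ (1 + ε₁)) ≤ (C₃ * η) ^ (1 + ε₁) := by
    have h1 : finavg B₁ (fun y => (σ y ^ 2) ^ (1 + ε₁)) =
        ((finavg B₁ (fun y => (σ y ^ 2) ^ (1 + ε₁))) ^ (1 / (1 + ε₁))) ^ (1 + ε₁) := by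
      rw [one_div, Real.rpow_inv_rpow havgF_nn hε₁1.ne']
    rw [h1]
    exact Real.rpow_le_rpow (Real.rpow_nonneg havgF_nn _) hM hε₁1.le
  have hsumF : ∑ᶠ y ∈ B₁, (σ y ^ 2) ^ (1 + ε₁) ≤ (B₁.ncard : ℝ) * (C₃ * η) ^ (1 + ε₁) := by
    rw [finsum_mem_eq_ncard_mul_finavg hB₁fin hne1]
    exact mul_le_mul_of_nonneg_left havgF (Nat.cast_nonneg _)
  -- Chebyshev in `ℓ^{1+ε₁}` above the threshold `t₀`
  have hwin1 : atomsIn (μS S) 0 R ⊆ B₁ := by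
    intro p hp
    rcases mem_atomsIn_iff.1 hp with ⟨hpS, hpn⟩
    exact ⟨hpS, mem_ball.2 (by rw [dist_zero_right]; linarith)⟩
  have hwinfin : (atomsIn (μS S) 0 R).Finite := hB₁fin.subset hwin1
  have hpt : ∀ x ∈ atomsIn (μS S) 0 R, T * (if t₀ ≤ σ x then σ x ^ 2 else 0) ≤ (σ x ^ 2) ^ (1 + ε₁) := by
    intro x _
    split_ifs with hx
    · have ht2 : t₀ ^ 2 ≤ σ x ^ 2 := pow_le_pow_left₀ ht₀.le hx 2
      have h1 : T ≤ (σ x ^ 2) ^ ε₁ := Real.rpow_le_rpow (by positivity) ht2 hε₁.le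
      calc T * σ x ^ 2 ≤ (σ x ^ 2) ^ ε₁ * σ x ^ 2 := mul_le_mul_of_nonneg_right h1 (sq_nonneg _)
        _ = (σ x ^ 2) ^ (1 + ε₁) := by
            rw [show (1 : ℝ) + ε₁ = ε₁ + 1 by ring, Real.rpow_add' (sq_nonneg _) (by linarith), Real.rpow_one]
    · rw [mul_zero]; exact hFnn x
  have hmass : T * strainMassAbove t₀ (atomsIn (μS S) 0 R) σ ≤ (B₁.ncard : ℝ) * (C₃ * η) ^ (1 + ε₁) := by
    unfold strainMassAbove
    rw [← winsum_const_mul hwinfin]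
    calc ∑ᶠ x ∈ atomsIn (μS S) 0 R, T * (if t₀ ≤ σ x then σ x ^ 2 else 0)
        ≤ ∑ᶠ x ∈ atomsIn (μS S) 0 R, (σ x ^ 2) ^ (1 + ε₁) := winsum_le_winsum_of_le hwinfin hpt
      _ ≤ ∑ᶠ x ∈ B₁, (σ x ^ 2) ^ (1 + ε₁) := finsum_mem_le_finsum_mem_of_subset_of_nonneg hB₁fin hwin1 (fun x _ => hFnn x)
      _ ≤ (B₁.ncard : ℝ) * (C₃ * η) ^ (1 + ε₁) := hsumF
  -- counting: `#B₁ ≤ nK(win (R+4)) ≤ c²·nK(win R)`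
  have hB₁count : (B₁.ncard : ℝ) ≤ c ^ 2 * nK (atomsIn (μS S) 0 R) := by
    have hsub : B₁ ⊆ atomsIn (μS S) 0 (R + 4) := by
      intro p hp
      refine mem_atomsIn_iff.2 ⟨hp.1, ?_⟩
      have h := mem_ball.1 hp.2
      rw [dist_zero_right] at h
      linarith
    calc (B₁.ncard : ℝ) ≤ nK (atomsIn (μS S) 0 (R + 4)) := by
          unfold nK
          exact_mod_cast Set.ncard_le_ncard hsub (finite_atomsIn hδ hsep _)
      _ ≤ c ^ 2 * nK (atomsIn (μS S) 0 R) := nK_atomsIn_add_four_le haHi hδ hS.1 hR12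
  -- smallness of `η^{ε₁}`
  have hC₃η : 0 ≤ C₃ * η := mul_nonneg hC₃0 hη.le
  have hpow : (C₃ * η) ^ (1 + ε₁) = C₃ * η * (C₃ * η) ^ ε₁ := by
    rw [Real.rpow_add' hC₃η (by linarith), Real.rpow_one]
  have hsmall : (C₃ * η) ^ ε₁ ≤ Kε := by
    have h1 : C₃ * η ≤ Kε ^ (1 / ε₁) := by
      have h2 : C₃ * η ≤ (C₃ + 1) * ηs :=
        (mul_le_mul_of_nonneg_right (by linarith : C₃ ≤ C₃ + 1) hη.le).trans (mul_le_mul_of_nonneg_left hηs' hC₃1.le)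
      have h3 : (C₃ + 1) * ηs = Kε ^ (1 / ε₁) := by
        rw [hηsdef, mul_comm, div_mul_cancel₀ _ hC₃1.ne']
      linarith
    calc (C₃ * η) ^ ε₁ ≤ (Kε ^ (1 / ε₁)) ^ ε₁ := Real.rpow_le_rpow hC₃η h1 hε₁.le
      _ = Kε := by rw [one_div, Real.rpow_inv_rpow hKε.le hε₁.ne']
  -- conclusion
  have hnKnn : 0 ≤ nK (atomsIn (μS S) 0 R) := nK_nonneg _
  have hfinal : T * strainMassAbove t₀ (atomsIn (μS S) 0 R) σ ≤ T * (ε * η * nK (atomsIn (μS S) 0 R)) := by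
    calc T * strainMassAbove t₀ (atomsIn (μS S) 0 R) σ ≤ (B₁.ncard : ℝ) * (C₃ * η) ^ (1 + ε₁) := hmass
      _ ≤ c ^ 2 * nK (atomsIn (μS S) 0 R) * (C₃ * η * Kε) := by
          rw [hpow]
          exact mul_le_mul hB₁count (mul_le_mul_of_nonneg_left hsmall hC₃η) (by positivity)
            (mul_nonneg (sq_nonneg c) hnKnn)
      _ = T * (ε * η * nK (atomsIn (μS S) 0 R)) * (c ^ 2 * C₃ / (c ^ 2 * (C₃ + 1))) := by
          rw [hKεdef]; ring
      _ ≤ T * (ε * η * nK (atomsIn (μS S) 0 R)) * 1 := by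
          apply mul_le_mul_of_nonneg_left _ (by positivity)
          rw [div_le_one (by positivity)]
          exact mul_le_mul_of_nonneg_left (by linarith) (sq_nonneg c)
      _ = T * (ε * η * nK (atomsIn (μS S) 0 R)) := mul_one _
  exact le_of_mul_le_mul_left hfinal hT

/-- ★★★ **COROLLARY (PROVED): `[C] ∧ Gehring-leaf ⇒ (M)`** — the line `_16XH19(_tol)`'s (M)-side seam:
`RigidCaccioppoliPG aHi Λ θ s → ZatorskaGoldstein2005_localGehringLemmaCounting → StrainNonConcentrationPG aHi Λ θ s` (`aHi ≤ 8/7`). -/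
theorem strainNonConcentrationPG_of_rigidCaccioppoliPG {aHi Λ θ s : ℝ} (haHi : aHi ≤ 8 / 7)
    (hG : ZatorskaGoldstein2005_localGehringLemmaCounting) (hC : RigidCaccioppoliPG aHi Λ θ s) :
    StrainNonConcentrationPG aHi Λ θ s :=
  strainNonConcentrationPG_of_strainSparsePG haHi (strainSparsePG_zero_of_rigidCaccioppoliPG haHi hG hC)

/-- Record example: at the line's literals `(aHi; Λ, θ, s) = (1; 2, 1/16, 1/50)`. -/
example (hG : ZatorskaGoldstein2005_localGehringLemmaCounting) (hC : RigidCaccioppoliPG 1 2 (1 / 16) (1 / 50)) :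
    StrainNonConcentrationPG 1 2 (1 / 16) (1 / 50) :=
  strainNonConcentrationPG_of_rigidCaccioppoliPG (by norm_num) hG hC

end Summit.AtomisticToContinuum.Crystallization.Theorems.ChartedZeroExcessLayeredLatticeLiouville

end
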